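import Literature.NumberTheory.IwasawaTheory.Fukuda1994Thm1RankPackageCoinvariant
import Literature.NumberTheory.IwasawaTheory.FukudaGroupCoinvariantLayer
import Literature.NumberTheory.IwasawaTheory.FukudaCoinvariantAlgebra
import Literature.NumberTheory.IwasawaTheory.ClassicalMuVanishesIffBoundedRank
import HarnessLib

/-!
# A ONE-PAIR-OF-LAYERS criterion for bounded `p`-ranks and `μ = 0` through GENUS THEORY: if the `Gal(K_{n+i+1}/K_{n+i})`-coinvariants of
# `Cl(K_{n+i+1})/p` have `p`-rank `c ≤ p^i − 1` (`n ≥` Fukuda's index), then `rank_p Cl(K_{n+k}) ≤ c` for EVERY `k` (door L12 of the cell `bsd-potss`; proved)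

`Proofs`-style file (theorems only: no definition, no named fact, no `sorry`) in topic `NumberTheory/IwasawaTheory`
(namespace = path), written by the prover seat `bsd-potss-k9-c4` g26 (cell `bsd-potss`; serves the `μ`-roads of the record lane of
stmt-BirchSwinnertonDyer-19197; closes nothing; no class group is computed here).

THE THEOREM (`classGroupPRank_le_of_coinvariant_index_le`).  `K` a number field, `p` a prime, `κ` a `ℤ_p`-extension of `K` totally ramified at
every ramified prime from layer `n₀` (`TotallyRamifiedFrom κ n₀`), `n ≥ n₀`, `i ≥ 0`, `c < p^i`.  IF the subgroup `Cl^p·⟨σx·x⁻¹ : σ ∈ Gal(K_{n+i+1}/K)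
fixing K_{n+i}⟩` of `Cl = Cl(K_{n+i+1})` has index `≤ p^c` — i.e. the `Gal(K_{n+i+1}/K_{n+i})`-COINVARIANTS of `Cl(K_{n+i+1})/p` have `p`-rank `≤ c` —
THEN `rank_p Cl(K_{n+k}) ≤ c` for EVERY `k ≥ 0`.  Consequently the `p`-ranks along the tower are bounded and Iwasawa's `μ`-invariant vanishes
(`classicalMuVanishes_of_coinvariant_index_le`, via the cell's finite-level «bounded ranks ⟹ `μ = 0`», `classicalMuVanishes_of_forall_classGroupPRank_le`).
Smallest useful case: `p = 3`, `n = n₀ = 0`, `i = 1`: **the `3`-rank of the `Gal(K₂/K₁)`-coinvariants of `Cl(K₂)` is `≤ 2` ⟹ all `rank₃ Cl(K_m) ≤ 2`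
and `μ = 0`** (`classicalMuVanishes_of_coinvariant_index_le_succ_succ`); `p = 5`, `i = 1`: coinvariant rank `≤ 4`.

WHY (Washington §13.3 in one line: `A_m/p ≅ X/(ν_m Y₀ + pX)` with `TX ⊆ Y₀ ⊆ X`; since `ν_{n+i+1} ≡ T^{p^{i+1}-1}` and `γ^{p^i} − 1 ≡ T^{p^i}` mod `p` with
`p^{i+1} − 1 ≥ p^i`, the coinvariants `(A_{n+i+1})_{Gal(K_{n+i+1}/K_{n+i})} ⊗ 𝔽_p ≅ X̄/T^{p^i}X̄` DO NOT DEPEND ON `Y₀`, and a free `𝔽_p⟦T⟧`-summand of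
`X̄ = X/pX` (`μ > 0`) contributes `p^i` to their dimension).  At finite level: the package `exists_layer_package_coinvariant` (this seat: k8t-c4's
package + the CFT export `[G_j : N_j·P_j·⁅G_i, G_j⁆] ∣ #coinvariants`, `UnramifiedElementaryCoinvariantModP`, equivariant Artin reciprocity +
centrality of the genus part), the group brick `FukudaGroup.card_quotient_le_relIndex_commutator_sup_layer_pow_sup_commutator`
(`N_j·P_j·⁅G_i,G_j⁆ ∩ A ⊆ ν_j Y₀ + pA + (φ^{p^i} − 1)A`) and the algebra brick `FukudaCoinvariant.card_quotient_le_of_card_quotient_coinvariant_lt`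
(chain lemma: `dim Ā/T^{p^i}Ā < p^i ⟹ T^{p^i} = 0 ⟹ Ā = Ā/T^{p^i}Ā` bounds every `#(A/(ν_k Y₀ + pA)) = p^{rank_p Cl(K_{n+k})}`).

COMPARISON.  Door L10 (`ClassGroupPRankSmallRankCriterion`, conjA-anchor g20) needs the FULL `rank_p Cl(K_{n+j}) < p^j − 1`; door L11
(`ClassGroupPRankCentralLayerCriterion`, conjA-anchor g21) needs `Gal(K_{n+j}/K)` TRIVIAL on `Cl(K_{n+j})/p`; this door tolerates a non-trivial
action and any rank at layer `n+i+1`, asking only that the COINVARIANT quotient be small — and that quotient is decided by genus theory in the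
layer `K_{n+i}` (Chevalley's unit norm index and a capitulation-type kernel: `rank = (s − 1 − r_E) + dim ker(A(K_{n+i})[p] → A(K_{n+i+1})_G)`),
WITHOUT the class group of the degree-`p`-times-larger field `K_{n+i+1}`.  At `p = 3`, `(n+i, n+i+1) = (1, 2)` it decides the rows where the
`3`-rank of `Cl(K₁)` is `2` with ONE Jordan block of `Gal(K₁/K)` (doors L10/L11 silent) as soon as the genus number of `K₂/K₁` has `3`-rank `2`.
Not found in print in this form; the ingredients are Washington's Lemma 13.18 / Prop. 13.22–13.23, Fukuda's finite-level method and
Chevalley–Lang genus theory, cited at each use (D-0014: our proof of a statement assembled from cited ingredients).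

References: [Washington1997] L. Washington, *Introduction to Cyclotomic Fields*, 2nd ed., §13.3 Lemmas 13.15, 13.18, Prop. 13.22, 13.23;
[Fukuda1994] T. Fukuda, *Remarks on ℤ_p-extensions of number fields*, Proc. Japan Acad. 70 A (1994), Thm. 1, p. 264; [Lang1990] S. Lang,
*Cyclotomic Fields I and II*, Ch. 13 §4 (Chevalley's ambiguous class number formula, genus theory in `ℤ_p`-extensions); [NeukirchANT1999] Ch. IV §6,
Ch. VI §7 Thm. (7.1).
-/

set_option autoImplicit false

noncomputable section

open scoped NumberField IsMulCommutative
open NumberField Field Finset IntermediateField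

namespace Literature.NumberTheory.IwasawaTheory

open Literature.NumberTheory.EllipticCurves Literature.NumberTheory.NumberFields

variable {K : Type} [Field K] [NumberField K] {p : ℕ} [hp : Fact p.Prime]

/-! ## §1 Inside the package: `r_{n+k} ≤ c` whenever the coinvariants of layer `n+i+1` over layer `n+i` have `p`-rank `c < p^i` -/

/-- The finite-level step: in the package of `K_n ⊆ K_{n+t} ⊆ H_p(K_{n+t})` (`t ≥ max(i+1, k)`), a coinvariant index `≤ p^c` with `c < p^i` at the
pair of layers `(n+i, n+i+1)` gives `rank_p Cl(K_{n+k}) ≤ c`. [cite: Washington1997, §13.3 Lemma 13.18 and Prop. 13.22] [cite: Fukuda1994, Thm. 1 (proof, p. 264)]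
[cite: Lang1990, Ch. 13 §4] -/
private theorem layer_coinvariant (κ : ZpExtension K p) {n₀ n : ℕ} (hκ : TotallyRamifiedFrom κ n₀) (hn : n₀ ≤ n) {i k t c : ℕ}
    (hit : i + 1 ≤ t) (hk : k ≤ t) (hc : c < p ^ i)
    (hco : ((powMonoidHom p : ClassGroup (𝓞 (κ.layer (n + (i + 1)))) →* ClassGroup (𝓞 (κ.layer (n + (i + 1))))).range ⊔
        Subgroup.closure {x | ∃ (σ : (κ.layer (n + (i + 1))) ≃ₐ[K] (κ.layer (n + (i + 1))))
          (_ : ∀ y : κ.layer (n + (i + 1)), ((y : κ.layer (n + (i + 1))) : AlgebraicClosure K) ∈ κ.layer (n + i) → σ y = y)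
          (x' : ClassGroup (𝓞 (κ.layer (n + (i + 1))))), x = ClassGroup.mulEquiv (AmbiguousClass.intAut σ) x' * x'⁻¹}).index ≤ p ^ c) :
    classGroupPRank κ (n + k) ≤ c := by
  classical
  have hp1 : 1 < p := hp.out.one_lt
  have ht : 1 ≤ t := le_trans (Nat.le_add_left 1 i) hit
  haveI : FiniteDimensional K (κ.layer (n + (i + 1))) := κ.finiteDimensional_layer_holds _
  haveI : NumberField (κ.layer (n + (i + 1))) := NumberField.of_module_finite K _
  obtain ⟨G, _instG, _instF, A', hA'n, _instC, g, 𝓘, hgA, hgen, hA'index, h𝓘, hg𝓘, hA'card, hlayer⟩ :=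
    exists_layer_package_coinvariant κ hκ hn t ht
  obtain ⟨Gj, hAGj, hGj, -, -, hcoj⟩ := hlayer (i + 1) hit
  obtain ⟨Gi, hAGi, hGi, -, -, -⟩ := hlayer i ((Nat.le_succ i).trans hit)
  obtain ⟨Gk, hAGk, hGk, -, hrk, -⟩ := hlayer k hk
  have hdvd := hcoj i (Nat.le_succ i)
  have hGieq : Gi = A' ⊔ Subgroup.zpowers (g ^ p ^ i) := FukudaGroup.layer_eq_sup_zpowers hgA hgen hA'index ((Nat.le_succ i).trans hit) hAGi hGi
  rw [← hGieq] at hdvd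
  -- the data of the bricks
  set Y : Submodule ℤ (Additive A') := FukudaGroup.subOf A' (⁅(⊤ : Subgroup G), ⊤⁆ ⊔ ⨆ I ∈ 𝓘, I) with hY
  set φ : Module.End ℤ (Additive A') := FukudaGroup.conjEnd A' g with hφ
  set P : Submodule ℤ (Additive A') := (⊤ : Submodule ℤ (Additive A')).map ((p : ℤ) • (1 : Module.End ℤ (Additive A')))
    with hP
  have hφt : φ ^ p ^ t = 1 := FukudaGroup.conjEnd_pow_index_eq_one hgA hgen hA'index
  -- `#(A/(ν_{i+1} Y + pA + (φ^{p^i} - 1)A)) ≤ [G_{i+1} : N P ⁅G_i, G_{i+1}⁆] ≤ p^c < p^{p^i}`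
  have hcard := FukudaGroup.card_quotient_le_relIndex_commutator_sup_layer_pow_sup_commutator hgA hgen hA'index h𝓘 hg𝓘
    (Nat.le_succ i) hit hAGi hGi hAGj hGj
  have hSpos : 0 < ((powMonoidHom p : ClassGroup (𝓞 (κ.layer (n + (i + 1)))) →* ClassGroup (𝓞 (κ.layer (n + (i + 1))))).range ⊔
        Subgroup.closure {x | ∃ (σ : (κ.layer (n + (i + 1))) ≃ₐ[K] (κ.layer (n + (i + 1))))
          (_ : ∀ y : κ.layer (n + (i + 1)), ((y : κ.layer (n + (i + 1))) : AlgebraicClosure K) ∈ κ.layer (n + i) → σ y = y)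
          (x' : ClassGroup (𝓞 (κ.layer (n + (i + 1))))), x = ClassGroup.mulEquiv (AmbiguousClass.intAut σ) x' * x'⁻¹}).index :=
    Nat.pos_of_ne_zero Subgroup.index_ne_zero_of_finite
  have hlt : Nat.card (Additive A' ⧸ ((Y.map (∑ m ∈ range (p ^ (i + 1)), φ ^ m) ⊔ P) ⊔
      (⊤ : Submodule ℤ (Additive A')).map (φ ^ p ^ i - 1))) < p ^ (p ^ i) :=
    calc Nat.card (Additive A' ⧸ ((Y.map (∑ m ∈ range (p ^ (i + 1)), φ ^ m) ⊔ P) ⊔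
          (⊤ : Submodule ℤ (Additive A')).map (φ ^ p ^ i - 1)))
        ≤ _ := hcard
      _ ≤ _ := Nat.le_of_dvd hSpos hdvd
      _ ≤ p ^ c := hco
      _ < p ^ (p ^ i) := Nat.pow_lt_pow_right hp1 hc
  -- `#(A/(ν_k Y + pA)) = p^{r_{n+k}}`
  have hquot : ((⁅Gk, Gk⁆ ⊔ ⨆ I ∈ 𝓘, I ⊓ Gk) ⊔ Subgroup.closure ((fun x : G => x ^ p) '' (Gk : Set G))).relIndex Gk =
      Nat.card (Additive A' ⧸ (Y.map (∑ m ∈ range (p ^ k), φ ^ m) ⊔ P)) := by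
    have hmul := FukudaGroup.relIndex_commutator_sup_layer_pow_mul_card hgA hgen hA'index h𝓘 hg𝓘 hk hAGk hGk
    have hcard' : Nat.card A' = Nat.card ↥(Y.map (∑ m ∈ range (p ^ k), φ ^ m) ⊔ P) *
        Nat.card (Additive A' ⧸ (Y.map (∑ m ∈ range (p ^ k), φ ^ m) ⊔ P)) :=
      Submodule.card_eq_card_quotient_mul_card (Y.map (∑ m ∈ range (p ^ k), φ ^ m) ⊔ P)
    rw [hcard', mul_comm (Nat.card ↥(Y.map _ ⊔ P))] at hmul
    exact Nat.eq_of_mul_eq_mul_right Nat.card_pos hmul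
  -- the algebra brick
  have hle := FukudaCoinvariant.card_quotient_le_of_card_quotient_coinvariant_lt (p := p) φ hφt Y (Nat.lt_succ_self i) hlt k
  have hle' : p ^ classGroupPRank κ (n + k) ≤ p ^ c := by
    rw [← hrk, hquot]
    exact hle.trans ((hcard.trans (Nat.le_of_dvd hSpos hdvd)).trans hco)
  exact (Nat.pow_le_pow_iff_right hp1).mp hle'

/-! ## §2 The criterion along the tower -/

/-- **ONE-PAIR-OF-LAYERS COINVARIANT CRITERION.**  `κ` a `ℤ_p`-extension of the number field `K`, totally ramified at the ramified primes from
layer `n₀` (`TotallyRamifiedFrom κ n₀`), `n₀ ≤ n`, `c < p^i`: if the subgroup `Cl^p·⟨σx·x⁻¹ : σ ∈ Gal(K_{n+i+1}/K) fixing K_{n+i} pointwise⟩` of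
`Cl(K_{n+i+1})` has index `≤ p^c` (the `Gal(K_{n+i+1}/K_{n+i})`-coinvariants of `Cl(K_{n+i+1})/p` have `p`-rank `≤ c`), then `rank_p Cl(K_{n+k}) ≤ c`
for every `k`.  (`p = 3`, `n = n₀`, `i = 1`: coinvariant `3`-rank `≤ 2` at the layers `(n₀+1, n₀+2)` bounds all `3`-ranks by it.)
[cite: Washington1997, §13.3 Lemma 13.18 and Prop. 13.22] [cite: Fukuda1994, Thm. 1 (proof, p. 264)] [cite: Lang1990, Ch. 13 §4] -/
theorem classGroupPRank_le_of_coinvariant_index_le (κ : ZpExtension K p) {n₀ n : ℕ} (hκ : TotallyRamifiedFrom κ n₀) (hn : n₀ ≤ n)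
    {i c : ℕ} (hc : c < p ^ i)
    (hco : ((powMonoidHom p : ClassGroup (𝓞 (κ.layer (n + (i + 1)))) →* ClassGroup (𝓞 (κ.layer (n + (i + 1))))).range ⊔
        Subgroup.closure {x | ∃ (σ : (κ.layer (n + (i + 1))) ≃ₐ[K] (κ.layer (n + (i + 1))))
          (_ : ∀ y : κ.layer (n + (i + 1)), ((y : κ.layer (n + (i + 1))) : AlgebraicClosure K) ∈ κ.layer (n + i) → σ y = y)
          (x' : ClassGroup (𝓞 (κ.layer (n + (i + 1))))), x = ClassGroup.mulEquiv (AmbiguousClass.intAut σ) x' * x'⁻¹}).index ≤ p ^ c)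
    (k : ℕ) : classGroupPRank κ (n + k) ≤ c :=
  layer_coinvariant κ hκ hn (t := max (i + 1) k) (le_max_left _ _) (le_max_right _ _) hc hco

/-- **Bounded `p`-ranks from one pair of layers**: under `TotallyRamifiedFrom κ n₀`, `n₀ ≤ n`, `c < p^i` and the coinvariant index bound at
`(n+i, n+i+1)`, the `p`-ranks `rank_p Cl(K_m)` are bounded (by the maximum of the finitely many ranks below layer `n` and `c`).
[cite: Washington1997, §13.3 Prop. 13.23] [cite: Fukuda1994, Thm. 1 (proof, p. 264)] -/
theorem exists_forall_classGroupPRank_le_of_coinvariant_index_le (κ : ZpExtension K p) {n₀ n : ℕ} (hκ : TotallyRamifiedFrom κ n₀)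
    (hn : n₀ ≤ n) {i c : ℕ} (hc : c < p ^ i)
    (hco : ((powMonoidHom p : ClassGroup (𝓞 (κ.layer (n + (i + 1)))) →* ClassGroup (𝓞 (κ.layer (n + (i + 1))))).range ⊔
        Subgroup.closure {x | ∃ (σ : (κ.layer (n + (i + 1))) ≃ₐ[K] (κ.layer (n + (i + 1))))
          (_ : ∀ y : κ.layer (n + (i + 1)), ((y : κ.layer (n + (i + 1))) : AlgebraicClosure K) ∈ κ.layer (n + i) → σ y = y)
          (x' : ClassGroup (𝓞 (κ.layer (n + (i + 1))))), x = ClassGroup.mulEquiv (AmbiguousClass.intAut σ) x' * x'⁻¹}).index ≤ p ^ c) :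
    ∃ B : ℕ, ∀ m, classGroupPRank κ m ≤ B := by
  refine ⟨(range n).sup (classGroupPRank κ) ⊔ c, fun m => ?_⟩
  rcases lt_or_ge m n with hm | hm
  · exact le_sup_of_le_left (Finset.le_sup (f := classGroupPRank κ) (mem_range.mpr hm))
  · obtain ⟨k, rfl⟩ : ∃ k, m = n + k := ⟨m - n, by omega⟩
    exact le_sup_of_le_right (classGroupPRank_le_of_coinvariant_index_le κ hκ hn hc hco k)

/-- **`μ = 0` from one pair of layers**: under `TotallyRamifiedFrom κ n₀`, `n₀ ≤ n`, `c < p^i` and the coinvariant index bound at `(n+i, n+i+1)`,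
Iwasawa's `μ`-invariant of `κ` vanishes (growth form `ClassicalMuVanishes`; via the cell's finite-level «bounded ranks ⟹ `μ = 0`»).
[cite: Washington1997, §13.3 Prop. 13.23] [cite: Fukuda1994, Thm. 1 (2), p. 264] [cite: Lang1990, Ch. 13 §4] -/
theorem classicalMuVanishes_of_coinvariant_index_le (κ : ZpExtension K p) {n₀ n : ℕ} (hκ : TotallyRamifiedFrom κ n₀) (hn : n₀ ≤ n)
    {i c : ℕ} (hc : c < p ^ i)
    (hco : ((powMonoidHom p : ClassGroup (𝓞 (κ.layer (n + (i + 1)))) →* ClassGroup (𝓞 (κ.layer (n + (i + 1))))).range ⊔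
        Subgroup.closure {x | ∃ (σ : (κ.layer (n + (i + 1))) ≃ₐ[K] (κ.layer (n + (i + 1))))
          (_ : ∀ y : κ.layer (n + (i + 1)), ((y : κ.layer (n + (i + 1))) : AlgebraicClosure K) ∈ κ.layer (n + i) → σ y = y)
          (x' : ClassGroup (𝓞 (κ.layer (n + (i + 1))))), x = ClassGroup.mulEquiv (AmbiguousClass.intAut σ) x' * x'⁻¹}).index ≤ p ^ c) :
    ClassicalMuVanishes κ := by
  obtain ⟨B, hB⟩ := exists_forall_classGroupPRank_le_of_coinvariant_index_le κ hκ hn hc hco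
  exact classicalMuVanishes_of_forall_classGroupPRank_le κ hB

/-- **Smallest case (`i = 1`, base layer `n₀`, the pair of layers `(n₀+1, n₀+2)`)**: `TotallyRamifiedFrom κ n₀` and a coinvariant index `≤ p^c`
with `c ≤ p − 1` for `Cl(K_{n₀+2})` under `Gal(K_{n₀+2}/K_{n₀+1})` give bounded `p`-ranks — packaged as `∃ B` — and `μ = 0`.  For `p = 3`: the
`3`-rank of the `Gal(K_{n₀+2}/K_{n₀+1})`-coinvariants of `Cl(K_{n₀+2})` is at most `2` (a genus-theory datum of the layer `K_{n₀+1}`).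
[cite: Washington1997, §13.3 Prop. 13.23] [cite: Fukuda1994, Thm. 1 (2), p. 264] [cite: Lang1990, Ch. 13 §4] -/
theorem classicalMuVanishes_of_coinvariant_index_le_succ_succ (κ : ZpExtension K p) {n₀ : ℕ} (hκ : TotallyRamifiedFrom κ n₀)
    {c : ℕ} (hc : c ≤ p - 1)
    (hco : ((powMonoidHom p : ClassGroup (𝓞 (κ.layer (n₀ + (1 + 1)))) →* ClassGroup (𝓞 (κ.layer (n₀ + (1 + 1))))).range ⊔
        Subgroup.closure {x | ∃ (σ : (κ.layer (n₀ + (1 + 1))) ≃ₐ[K] (κ.layer (n₀ + (1 + 1))))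
          (_ : ∀ y : κ.layer (n₀ + (1 + 1)), ((y : κ.layer (n₀ + (1 + 1))) : AlgebraicClosure K) ∈ κ.layer (n₀ + 1) → σ y = y)
          (x' : ClassGroup (𝓞 (κ.layer (n₀ + (1 + 1))))), x = ClassGroup.mulEquiv (AmbiguousClass.intAut σ) x' * x'⁻¹}).index ≤ p ^ c) :
    (∃ B : ℕ, ∀ m, classGroupPRank κ m ≤ B) ∧ ClassicalMuVanishes κ := by
  have hp2 : 2 ≤ p := hp.out.two_le
  have hc' : c < p ^ 1 := by rw [pow_one]; omega
  exact ⟨exists_forall_classGroupPRank_le_of_coinvariant_index_le κ hκ le_rfl hc' hco,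
    classicalMuVanishes_of_coinvariant_index_le κ hκ le_rfl hc' hco⟩

end Literature.NumberTheory.IwasawaTheory

end
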